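import Literature.NumberTheory.GaloisRepresentations.AlgebraicHeckeCharacterGrossencharakterProofs
import Literature.NumberTheory.GaloisRepresentations.OrdinaryRegular
import HarnessLib

/-!
# Every `ℓ`-adic embedding of a number field factors continuously through a completion above `ℓ`

For a number field `K`, a prime `ℓ` and a ring embedding `τ : K → ℚ̄_ℓ` (`PadicAlgCl ℓ`):

* `PadicEmbedding.place τ : HeightOneSpectrum (𝓞 K)` — the prime `𝔭_τ = {d ∈ 𝒪_K : ‖τ d‖ < 1}`,
  which lies above `ℓ` (`natCast_mem_place`);
* `PadicEmbedding.norm_lt_one_iff` — `‖τ a‖ < 1 ↔ |a|_{𝔭_τ} < 1` for all `a ∈ K` (denominators prime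
  to `𝔭_τ`, `exists_mul_eq_of_valuation_le_one`), whence `‖τ ·‖` and the `𝔭_τ`-adic absolute value are
  equivalent (`abv_isEquiv_adicAbv`, `exists_norm_eq_adicAbv_rpow`);
* `PadicEmbedding.lift τ : (place τ).adicCompletion K →+* PadicAlgCl ℓ` — the unique continuous extension
  of `τ` to the completion (`lift_algebraMap`, `continuous_lift`, `eq_lift_of_continuous`), constructed by
  extending the uniformly continuous `τ : K → E_τ = ℚ_ℓ(τ θ)` (a complete finite extension of `ℚ_ℓ`)
  from the dense subfield `K ⊂ K_{𝔭_τ}`;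
* `PadicEmbedding.placeEmbEquiv K ℓ : PlaceEmb K ℓ ≃ (K →+* PadicAlgCl ℓ)` — the bijection between pairs
  `(v ∣ ℓ, e : K_v → ℚ̄_ℓ continuous)` and embeddings `K → ℚ̄_ℓ`, `(v, e) ↦ e ∘ ι_v`
  (`place_comp_algebraMap`, `eq_of_comp_algebraMap_eq`, `finprod_embedding_eq_finprod_placeEmb`).

This is the dictionary "embeddings `K → ℚ̄_ℓ` = places above `ℓ` with an embedding of the completion"
used by Serre to pass between the global algebraic part `∏_τ τ(x)^{n_τ}` of a locally algebraic
`ℓ`-adic character and its local shape at the places `v ∣ ℓ`.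

References: J.-P. Serre, *Abelian ℓ-adic representations and elliptic curves* (1968), Ch. II §3.1,
Ch. III §1.1; J. Neukirch, *Algebraic Number Theory*, Ch. II (8.1)–(8.3) (extensions of valuations
and embeddings of completions).
-/

noncomputable section

open scoped NumberField nonZeroDivisors IntermediateField
open NumberField IsDedekindDomain IsDedekindDomain.HeightOneSpectrum

namespace Literature.NumberTheory.GaloisRepresentations

variable {K : Type} [Field K] [NumberField K] {ℓ : ℕ} [Fact ℓ.Prime]

namespace PadicEmbedding

/-- The absolute value `a ↦ ‖τ a‖` on `K` defined by an embedding `τ : K → ℚ̄_ℓ`. [folklore] -/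
def abv (τ : K →+* PadicAlgCl ℓ) : AbsoluteValue K ℝ where
  toFun a := ‖τ a‖
  map_mul' a b := by rw [map_mul, norm_mul]
  nonneg' a := norm_nonneg _
  eq_zero' a := by rw [norm_eq_zero, map_eq_zero]
  add_le' a b := by rw [map_add]; exact norm_add_le _ _

/-- Unfolding of `abv`. [folklore] -/
@[simp] theorem abv_apply (τ : K →+* PadicAlgCl ℓ) (a : K) : abv τ a = ‖τ a‖ := rfl

/-- The ultrametric inequality for `‖τ ·‖`. [folklore] -/
theorem norm_map_add_le_max (τ : K →+* PadicAlgCl ℓ) (a b : K) :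
    ‖τ (a + b)‖ ≤ max ‖τ a‖ ‖τ b‖ := by
  rw [map_add]; exact PadicAlgCl.isNonarchimedean ℓ _ _

/-- **The prime `𝔭_τ = {d ∈ 𝒪_K : ‖τ d‖ < 1}` of an `ℓ`-adic embedding.** [folklore] -/
def ideal (τ : K →+* PadicAlgCl ℓ) : Ideal (𝓞 K) where
  carrier := {d | ‖τ (d : K)‖ < 1}
  add_mem' {a b} ha hb := by
    change ‖τ (((a + b : 𝓞 K) : K))‖ < 1
    rw [RingOfIntegers.coe_eq_algebraMap, map_add]
    exact (norm_map_add_le_max τ _ _).trans_lt (max_lt ha hb)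
  zero_mem' := by change ‖τ ((0 : 𝓞 K) : K)‖ < 1; simp
  smul_mem' c {d} hd := by
    change ‖τ (((c * d : 𝓞 K) : K))‖ < 1
    rw [RingOfIntegers.coe_eq_algebraMap, map_mul, map_mul, norm_mul]
    calc ‖τ (algebraMap (𝓞 K) K c)‖ * ‖τ (algebraMap (𝓞 K) K d)‖
        ≤ 1 * ‖τ (algebraMap (𝓞 K) K d)‖ :=
          mul_le_mul_of_nonneg_right (norm_embedding_coe_le_one τ c) (norm_nonneg _)
      _ < 1 := by rw [one_mul]; exact hd

/-- Membership in `𝔭_τ`. [folklore] -/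
theorem mem_ideal_iff (τ : K →+* PadicAlgCl ℓ) (d : 𝓞 K) : d ∈ ideal τ ↔ ‖τ (d : K)‖ < 1 := Iff.rfl

/-- `ℓ ∈ 𝔭_τ`. [folklore] -/
theorem natCast_mem_ideal (τ : K →+* PadicAlgCl ℓ) : ((ℓ : ℕ) : 𝓞 K) ∈ ideal τ := by
  rw [mem_ideal_iff]
  have : τ (((ℓ : ℕ) : 𝓞 K) : K) = (ℓ : PadicAlgCl ℓ) := by simp
  rw [this]
  exact Automorphic.PadicAlgCl.norm_natCast_p_lt_one ℓ

/-- `𝔭_τ` is a prime ideal. [folklore] -/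
theorem isPrime_ideal (τ : K →+* PadicAlgCl ℓ) : (ideal τ).IsPrime := by
  refine ⟨fun h => ?_, fun {a b} hab => ?_⟩
  · have h1 : (1 : 𝓞 K) ∈ ideal τ := by rw [h]; exact Submodule.mem_top
    rw [mem_ideal_iff] at h1
    simp at h1
  · rw [mem_ideal_iff, RingOfIntegers.coe_eq_algebraMap, map_mul, map_mul, norm_mul] at hab
    by_contra h
    simp only [not_or, mem_ideal_iff, not_lt] at h
    have ha : ‖τ (a : K)‖ = 1 := le_antisymm (norm_embedding_coe_le_one τ a) h.1
    have hb : ‖τ (b : K)‖ = 1 := le_antisymm (norm_embedding_coe_le_one τ b) h.2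
    rw [RingOfIntegers.coe_eq_algebraMap] at ha hb
    rw [ha, hb, mul_one] at hab
    exact lt_irrefl _ hab

/-- `𝔭_τ ≠ 0`. [folklore] -/
theorem ideal_ne_bot (τ : K →+* PadicAlgCl ℓ) : ideal τ ≠ ⊥ := fun h => by
  have hmem := natCast_mem_ideal τ
  rw [h, Ideal.mem_bot] at hmem
  exact (Fact.out : ℓ.Prime).ne_zero (by exact_mod_cast hmem)

/-- **The place `v_τ ∣ ℓ` of an `ℓ`-adic embedding `τ : K → ℚ̄_ℓ`.** [folklore] -/
def place (τ : K →+* PadicAlgCl ℓ) : HeightOneSpectrum (𝓞 K) :=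
  ⟨ideal τ, isPrime_ideal τ, ideal_ne_bot τ⟩

/-- `v_τ` lies above `ℓ`. [folklore] -/
theorem natCast_mem_place (τ : K →+* PadicAlgCl ℓ) : ((ℓ : ℕ) : 𝓞 K) ∈ (place τ).asIdeal :=
  natCast_mem_ideal τ

/-- Integers outside `𝔭_τ` are `τ`-units. [folklore] -/
theorem norm_eq_one_of_not_mem {τ : K →+* PadicAlgCl ℓ} {s : 𝓞 K} (hs : s ∉ (place τ).asIdeal) :
    ‖τ (s : K)‖ = 1 :=
  le_antisymm (norm_embedding_coe_le_one τ s) (not_lt.mp hs)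

/-- **Denominators outside a given prime**: an element of `K` integral at `v` is `n/s` with
`n, s ∈ 𝒪_K`, `s ∉ 𝔭_v` (Chinese remainder theorem at the poles). [folklore] -/
theorem exists_mul_eq_of_valuation_le_one (v : HeightOneSpectrum (𝓞 K)) {a : K}
    (ha : v.valuation K a ≤ 1) :
    ∃ n s : 𝓞 K, s ∉ v.asIdeal ∧ (s : K) * a = n := by
  classical
  obtain ⟨⟨d, hd⟩, b, hb⟩ := IsLocalization.exists_integer_multiple (𝓞 K)⁰ a
  change algebraMap (𝓞 K) K b = (d : 𝓞 K) • a at hb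
  rw [Algebra.smul_def] at hb
  have hd0 : (d : 𝓞 K) ≠ 0 := nonZeroDivisors.ne_zero hd
  have hdI : (Ideal.span {d} : Ideal (𝓞 K)) ≠ ⊥ := by rwa [Ne, Ideal.span_singleton_eq_bot]
  -- multiplicities of the primes in `(d)`
  set m : HeightOneSpectrum (𝓞 K) → ℕ := fun w =>
    (Associates.mk w.asIdeal).count (Associates.mk (Ideal.span {d} : Ideal (𝓞 K))).factors with hm
  have hval_d : ∀ w : HeightOneSpectrum (𝓞 K), w.valuation K (d : K) = WithZero.exp (-(m w : ℤ)) := by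
    intro w
    rw [show ((d : 𝓞 K) : K) = algebraMap (𝓞 K) K d from rfl, valuation_of_algebraMap,
      intValuation_if_neg _ hd0]
  set S : Finset (HeightOneSpectrum (𝓞 K)) := (Ideal.finite_factors hdI).toFinset with hS
  -- Chinese remainder theorem: `y ≡ 1 mod v`, `y ∈ w^{m_w}` for `w ∣ (d)`, `w ≠ v`
  obtain ⟨y, hy⟩ := IsDedekindDomain.exists_forall_sub_mem_ideal (s := insert v S)
    (fun w : HeightOneSpectrum (𝓞 K) => w.asIdeal) (fun w => if w = v then 1 else m w) (fun w _ => w.prime)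
    (fun i _ j _ hij => fun h => hij (HeightOneSpectrum.ext h))
    (fun w => if w.1 = v then 1 else 0)
  have hyv : y ∉ v.asIdeal := by
    intro hyv
    have h1 := hy v (Finset.mem_insert_self v S)
    simp only [if_true] at h1
    rw [pow_one] at h1
    have : (1 : 𝓞 K) ∈ v.asIdeal := by simpa using v.asIdeal.sub_mem hyv h1
    exact v.isPrime.ne_top ((Ideal.eq_top_iff_one _).mpr this)
  have hyw : ∀ w ∈ S, w ≠ v → y ∈ w.asIdeal ^ m w := by
    intro w hw hwv
    have h1 := hy w (Finset.mem_insert_of_mem hw)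
    simp only [hwv, if_false, sub_zero] at h1
    exact h1
  -- integrality of `y a`
  have hint : ∀ w : HeightOneSpectrum (𝓞 K), w.valuation K ((y : K) * a) ≤ 1 := by
    intro w
    rw [map_mul]
    have hya : w.valuation K (y : K) ≤ 1 := valuation_le_one w y
    by_cases hwv : w = v
    · subst hwv
      calc w.valuation K (y : K) * w.valuation K a ≤ 1 * 1 := mul_le_mul' hya ha
        _ = 1 := one_mul _
    · have hab : w.valuation K (d : K) * w.valuation K a = w.valuation K (b : K) := by
        rw [← map_mul, ← hb]
      by_cases hwS : w ∈ S
      · have hym : w.valuation K (y : K) ≤ w.valuation K (d : K) := by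
          rw [hval_d, show ((y : 𝓞 K) : K) = algebraMap (𝓞 K) K y from rfl, valuation_of_algebraMap]
          exact (intValuation_le_pow_iff_mem w y (m w)).mpr (hyw w hwS hwv)
        calc w.valuation K (y : K) * w.valuation K a ≤ w.valuation K (d : K) * w.valuation K a :=
              mul_le_mul_left hym _
          _ = w.valuation K (b : K) := hab
          _ ≤ 1 := valuation_le_one w b
      · -- `w ∤ (d)`: `|d|_w = 1`
        have hmw : m w = 0 := by
          by_contra hne
          apply hwS
          rw [hS, Set.Finite.mem_toFinset, Set.mem_setOf_eq]
          exact (Associates.count_ne_zero_iff_dvd hdI w.irreducible).mp hne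
        have hd1 : w.valuation K (d : K) = 1 := by rw [hval_d, hmw]; rfl
        rw [hd1, one_mul] at hab
        calc w.valuation K (y : K) * w.valuation K a ≤ 1 * w.valuation K a := mul_le_mul_left hya _
          _ = w.valuation K (b : K) := by rw [one_mul, hab]
          _ ≤ 1 := valuation_le_one w b
  obtain ⟨n, hn⟩ := HeightOneSpectrum.mem_integers_of_valuation_le_one K ((y : K) * a) hint
  exact ⟨n, y, hyv, hn.symm⟩

/-- **`‖τ a‖ < 1 ↔ |a|_{v_τ} < 1`** for every `a ∈ K` (write a `v_τ`-integral `a` as `n/s` with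
`s ∉ 𝔭_τ`, a `τ`-unit). [folklore] -/
theorem norm_lt_one_iff (τ : K →+* PadicAlgCl ℓ) (a : K) :
    ‖τ a‖ < 1 ↔ (place τ).valuation K a < 1 := by
  -- integral case
  have key : ∀ a : K, (place τ).valuation K a ≤ 1 → (‖τ a‖ < 1 ↔ (place τ).valuation K a < 1) := by
    intro a ha
    obtain ⟨n, s, hs, hsa⟩ := exists_mul_eq_of_valuation_le_one (place τ) ha
    have hs1 : ‖τ (s : K)‖ = 1 := norm_eq_one_of_not_mem hs
    have hsv : (place τ).valuation K (s : K) = 1 := by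
      rw [show ((s : 𝓞 K) : K) = algebraMap (𝓞 K) K s from rfl]
      exact (valuation_eq_one_iff_notMem (v := place τ) (K := K)).mpr hs
    have h1 : ‖τ a‖ = ‖τ (n : K)‖ := by rw [← hsa, map_mul, norm_mul, hs1, one_mul]
    have h2 : (place τ).valuation K a = (place τ).valuation K (n : K) := by rw [← hsa, map_mul, hsv, one_mul]
    rw [h1, h2, show ((n : 𝓞 K) : K) = algebraMap (𝓞 K) K n from rfl, valuation_lt_one_iff_mem]
    exact (mem_ideal_iff τ n).symm
  by_cases ha : (place τ).valuation K a ≤ 1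
  · exact key a ha
  · -- `|a|_v > 1`: then `a⁻¹` is integral with `|a⁻¹|_v < 1`, so `‖τ a⁻¹‖ < 1`
    rw [not_le] at ha
    have ha0 : a ≠ 0 := by rintro rfl; simp at ha
    have hinv : (place τ).valuation K a⁻¹ < 1 := by
      rw [map_inv₀]; exact inv_lt_one_of_one_lt₀ ha
    have h := (key a⁻¹ hinv.le).mpr hinv
    rw [map_inv₀, norm_inv] at h
    have hτa : 1 < ‖τ a‖ := by
      have h0 : 0 < ‖τ a‖ := norm_pos_iff.mpr ((map_ne_zero τ).mpr ha0)
      exact (inv_lt_one_iff₀.mp h).resolve_left (not_le.mpr h0)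
    constructor
    · intro h'; exact absurd (h'.trans hτa) (lt_irrefl _)
    · intro h'; exact absurd (h'.trans ha) (lt_irrefl _)

/-! ### Equivalence with the `v_τ`-adic absolute value, continuity, extension to `K_{v_τ}` -/

/-- **`‖τ ·‖` is equivalent to the `v_τ`-adic absolute value.** [folklore] -/
theorem abv_isEquiv_adicAbv (τ : K →+* PadicAlgCl ℓ) :
    (abv τ).IsEquiv (NumberField.HeightOneSpectrum.adicAbv K (place τ)) := by
  refine AbsoluteValue.isEquiv_iff_lt_one_iff.mpr fun a => ?_
  rw [abv_apply, norm_lt_one_iff, NumberField.HeightOneSpectrum.adicAbv_def, ← NNReal.coe_one,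
    NNReal.coe_lt_coe, WithZeroMulInt.toNNReal_lt_one_iff (NumberField.HeightOneSpectrum.one_lt_absNorm_nnreal _)]

/-- `‖τ a‖ = |a|_{v_τ}^c` for a positive constant `c`. [folklore] -/
theorem exists_norm_eq_adicAbv_rpow (τ : K →+* PadicAlgCl ℓ) :
    ∃ c : ℝ, 0 < c ∧ ∀ a : K, ‖τ a‖ = (NumberField.HeightOneSpectrum.adicAbv K (place τ) a) ^ c := by
  obtain ⟨c, hc, h⟩ := AbsoluteValue.isEquiv_iff_exists_rpow_eq.mp (abv_isEquiv_adicAbv τ).symm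
  exact ⟨c, hc, fun a => (congrFun h a).symm⟩

/-- A primitive element of `K/ℚ` (a choice). [folklore] -/
def primElt (K : Type) [Field K] [NumberField K] : K := (Field.exists_primitive_element ℚ K).choose

/-- `ℚ⟮θ⟯ = K`. [folklore] -/
theorem adjoin_primElt : ℚ⟮primElt K⟯ = ⊤ := (Field.exists_primitive_element ℚ K).choose_spec

/-- **The field of values `E_τ = ℚ_ℓ(τ θ)`**, a finite extension of `ℚ_ℓ` inside `ℚ̄_ℓ` containing `τ(K)`. [folklore] -/
def valueField (τ : K →+* PadicAlgCl ℓ) : IntermediateField ℚ_[ℓ] (PadicAlgCl ℓ) :=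
  IntermediateField.adjoin ℚ_[ℓ] {τ (primElt K)}

/-- `E_τ` is finite-dimensional over `ℚ_ℓ`. [folklore] -/
instance finiteDimensional_valueField (τ : K →+* PadicAlgCl ℓ) : FiniteDimensional ℚ_[ℓ] (valueField τ) :=
  IntermediateField.adjoin.finiteDimensional (Algebra.IsAlgebraic.isAlgebraic (R := ℚ_[ℓ]) _).isIntegral

/-- `E_τ` is complete. [folklore] -/
instance completeSpace_valueField (τ : K →+* PadicAlgCl ℓ) : CompleteSpace (valueField τ) :=
  FiniteDimensional.complete ℚ_[ℓ] (valueField τ)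

/-- `τ(K) ⊆ E_τ`. [folklore] -/
theorem map_mem_valueField (τ : K →+* PadicAlgCl ℓ) (x : K) : τ x ∈ valueField τ := by
  have hx : x ∈ ℚ⟮primElt K⟯ := by rw [adjoin_primElt]; exact IntermediateField.mem_top
  obtain ⟨r, s', hrs⟩ := (IntermediateField.mem_adjoin_simple_iff (F := ℚ) x).mp hx
  have hC : ∀ a : ℚ, algebraMap ℚ (PadicAlgCl ℓ) a ∈ valueField τ := by
    intro a
    have : algebraMap ℚ (PadicAlgCl ℓ) a = algebraMap ℚ_[ℓ] (PadicAlgCl ℓ) (a : ℚ_[ℓ]) := by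
      rw [eq_ratCast, map_ratCast]
    rw [this]
    exact IntermediateField.algebraMap_mem _ _
  have hpoly : ∀ f : Polynomial ℚ, τ (Polynomial.aeval (primElt K) f) ∈ valueField τ := by
    intro f
    rw [show τ (Polynomial.aeval (primElt K) f) = Polynomial.aeval (τ (primElt K)) f from
      (Polynomial.aeval_algHom_apply τ.toRatAlgHom (primElt K) f).symm]
    induction f using Polynomial.induction_on with
    | C a => rw [Polynomial.aeval_C]; exact hC a
    | add f g hf hg => rw [map_add]; exact add_mem hf hg
    | monomial n a _ =>
      rw [map_mul, Polynomial.aeval_C, map_pow, Polynomial.aeval_X]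
      exact mul_mem (hC a) (pow_mem (IntermediateField.mem_adjoin_simple_self ℚ_[ℓ] _) _)
  rw [hrs, map_div₀]
  exact div_mem (hpoly r) (hpoly s')

/-- `τ` with values in `E_τ`. [folklore] -/
def toValueField (τ : K →+* PadicAlgCl ℓ) : K →+* valueField τ :=
  τ.codRestrict (valueField τ).toSubring (map_mem_valueField τ)

/-- Unfolding. [folklore] -/
@[simp] theorem coe_toValueField (τ : K →+* PadicAlgCl ℓ) (a : K) :
    ((toValueField τ a : valueField τ) : PadicAlgCl ℓ) = τ a := rfl

/-- The norm in `E_τ` is that of `ℚ̄_ℓ`. [folklore] -/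
theorem norm_toValueField (τ : K →+* PadicAlgCl ℓ) (a : K) : ‖toValueField τ a‖ = ‖τ a‖ := rfl

/-- The canonical map `K → K_v` is the embedding of `FinitePlace`. [folklore] -/
theorem algebraMap_eq_embedding (v : HeightOneSpectrum (𝓞 K)) (a : K) :
    algebraMap K (v.adicCompletion K) a = NumberField.FinitePlace.embedding v a := rfl

/-- `‖a‖_{K_v} = |a|_v`. [folklore] -/
theorem norm_algebraMap_adicCompletion (v : HeightOneSpectrum (𝓞 K)) (a : K) :
    ‖algebraMap K (v.adicCompletion K) a‖ = NumberField.HeightOneSpectrum.adicAbv K v a := by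
  rw [algebraMap_eq_embedding]; exact NumberField.FinitePlace.norm_embedding v a

/-- **`τ` is uniformly continuous for the `v_τ`-adic uniformity on `K`** (`‖τ a‖ = |a|_{v_τ}^c`).
[folklore] -/
theorem uniformContinuous_toValueField (τ : K →+* PadicAlgCl ℓ) :
    letI : UniformSpace K := UniformSpace.comap (algebraMap K ((place τ).adicCompletion K)) inferInstance
    UniformContinuous (toValueField τ) := by
  letI : UniformSpace K := UniformSpace.comap (algebraMap K ((place τ).adicCompletion K)) inferInstance
  obtain ⟨c, hc, hceq⟩ := exists_norm_eq_adicAbv_rpow τ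
  rw [UniformContinuous, uniformity_comap,
    ((Metric.uniformity_basis_dist.comap _).tendsto_iff Metric.uniformity_basis_dist)]
  intro ε hε
  refine ⟨ε ^ (1 / c), Real.rpow_pos_of_pos hε _, fun p hp => ?_⟩
  rw [Set.mem_setOf_eq, dist_eq_norm, ← map_sub, norm_toValueField, hceq, ← norm_algebraMap_adicCompletion,
    map_sub, ← dist_eq_norm]
  rw [Set.mem_preimage, Set.mem_setOf_eq] at hp
  calc dist (algebraMap K ((place τ).adicCompletion K) p.1) (algebraMap K ((place τ).adicCompletion K) p.2) ^ c
      < (ε ^ (1 / c)) ^ c := Real.rpow_lt_rpow dist_nonneg hp hc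
    _ = ε := by rw [← Real.rpow_mul hε.le, one_div_mul_cancel hc.ne', Real.rpow_one]

/-- **The continuous extension `τ̂ : K_{v_τ} → E_τ` of `τ`** (extension from the dense subfield `K`).
[cite: SerreAbelianLadic1968, Ch. II §3.1] -/
def extend (τ : K →+* PadicAlgCl ℓ) : (place τ).adicCompletion K →+* valueField τ :=
  letI : UniformSpace K := UniformSpace.comap (algebraMap K ((place τ).adicCompletion K)) inferInstance
  IsDenseInducing.extendRingHom (i := algebraMap K ((place τ).adicCompletion K)) ⟨rfl⟩
    (denseRange_algebraMap K (place τ)) (uniformContinuous_toValueField τ)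

/-- `τ̂` extends `τ`. [folklore] -/
theorem extend_algebraMap (τ : K →+* PadicAlgCl ℓ) (a : K) :
    extend τ (algebraMap K ((place τ).adicCompletion K) a) = toValueField τ a := by
  letI : UniformSpace K := UniformSpace.comap (algebraMap K ((place τ).adicCompletion K)) inferInstance
  have ue : IsUniformInducing (algebraMap K ((place τ).adicCompletion K)) := ⟨rfl⟩
  exact IsDenseInducing.extend_eq (ue.isDenseInducing (denseRange_algebraMap K (place τ)))
    (uniformContinuous_toValueField τ).continuous a

/-- `τ̂` is continuous. [folklore] -/
theorem continuous_extend (τ : K →+* PadicAlgCl ℓ) : Continuous (extend τ) := by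
  letI : UniformSpace K := UniformSpace.comap (algebraMap K ((place τ).adicCompletion K)) inferInstance
  have ue : IsUniformInducing (algebraMap K ((place τ).adicCompletion K)) := ⟨rfl⟩
  exact (uniformContinuous_uniformly_extend ue (denseRange_algebraMap K (place τ))
    (uniformContinuous_toValueField τ)).continuous

/-- **The continuous extension `τ̂ : K_{v_τ} → ℚ̄_ℓ` of an `ℓ`-adic embedding `τ : K → ℚ̄_ℓ` to the
completion at its place `v_τ ∣ ℓ`.** [cite: SerreAbelianLadic1968, Ch. II §3.1] -/
def lift (τ : K →+* PadicAlgCl ℓ) : (place τ).adicCompletion K →+* PadicAlgCl ℓ :=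
  (valueField τ).toSubring.subtype.comp (extend τ)

/-- `τ̂` extends `τ`: `τ̂(a) = τ(a)` for `a ∈ K`. [folklore] -/
theorem lift_algebraMap (τ : K →+* PadicAlgCl ℓ) (a : K) :
    lift τ (algebraMap K ((place τ).adicCompletion K) a) = τ a := by
  rw [lift, RingHom.comp_apply, extend_algebraMap]; rfl

/-- `τ̂` is continuous. [folklore] -/
theorem continuous_lift (τ : K →+* PadicAlgCl ℓ) : Continuous (lift τ) :=
  continuous_subtype_val.comp (continuous_extend τ)

/-- `τ̂` is the unique continuous extension. [folklore] -/
theorem eq_lift_of_continuous (τ : K →+* PadicAlgCl ℓ) {g : (place τ).adicCompletion K →+* PadicAlgCl ℓ}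
    (hg : Continuous g) (h : ∀ a : K, g (algebraMap K _ a) = τ a) : g = lift τ := by
  refine RingHom.ext fun x => ?_
  refine congrFun ((denseRange_algebraMap K (place τ)).equalizer hg (continuous_lift τ) ?_) x
  exact funext fun a => by simp only [Function.comp_apply, h, lift_algebraMap]

/-! ### The bijection `τ ↔ (v_τ, τ̂)` -/

/-- For a continuous `e : K_v → ℚ̄_ℓ` and `d ∈ 𝒪_K`: **`‖e(d)‖ < 1 ↔ d ∈ 𝔭_v`.** [folklore] -/
theorem norm_map_algebraMap_lt_one_iff {v : HeightOneSpectrum (𝓞 K)} (e : v.adicCompletion K →+* PadicAlgCl ℓ)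
    (he : Continuous e) (d : 𝓞 K) : ‖e (algebraMap K (v.adicCompletion K) (d : K))‖ < 1 ↔ d ∈ v.asIdeal := by
  -- `d ∈ 𝔭_v ⇒ d^n → 0` in `K_v`, hence in `ℚ̄_ℓ`
  have key : ∀ d : 𝓞 K, d ∈ v.asIdeal → ‖e (algebraMap K (v.adicCompletion K) (d : K))‖ < 1 := by
    intro d hd
    set y : v.adicCompletion K := algebraMap K (v.adicCompletion K) (d : K) with hy
    have hy1 : ‖y‖ < 1 := by
      rw [hy, show ((d : 𝓞 K) : K) = algebraMap (𝓞 K) K d from rfl, algebraMap_eq_embedding]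
      exact (NumberField.FinitePlace.norm_lt_one_iff_mem K v d).mpr hd
    have h1 : Filter.Tendsto (fun n : ℕ => y ^ n) Filter.atTop (nhds 0) :=
      tendsto_pow_atTop_nhds_zero_of_norm_lt_one hy1
    have h2 : Filter.Tendsto (fun n : ℕ => ‖e y‖ ^ n) Filter.atTop (nhds 0) := by
      have h3 : Filter.Tendsto (fun n : ℕ => e (y ^ n)) Filter.atTop (nhds 0) := by
        simpa only [Function.comp_def, map_zero] using (he.tendsto 0).comp h1
      have h4 := (continuous_norm.tendsto (0 : PadicAlgCl ℓ)).comp h3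
      simpa only [Function.comp_def, map_pow, norm_pow, norm_zero] using h4
    have h5 := tendsto_pow_atTop_nhds_zero_iff.mp h2
    rwa [abs_of_nonneg (norm_nonneg _)] at h5
  refine ⟨fun h => ?_, key d⟩
  by_contra hd
  -- `d ∉ 𝔭_v`: `d r = 1 + m` with `m ∈ 𝔭_v`, so `‖e d‖ ‖e r‖ = ‖1 + e m‖ = 1`
  letI := Ideal.Quotient.field v.asIdeal
  obtain ⟨r, hr⟩ := Ideal.Quotient.mk_surjective (I := v.asIdeal) ((Ideal.Quotient.mk v.asIdeal d)⁻¹)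
  have hdr : d * r - 1 ∈ v.asIdeal := by
    rw [← Ideal.Quotient.eq_zero_iff_mem, map_sub, map_one, map_mul, hr,
      mul_inv_cancel₀ ((Ideal.Quotient.eq_zero_iff_mem).not.mpr hd), sub_self]
  have hm := key _ hdr
  have heq : e (algebraMap K _ ((d : 𝓞 K) : K)) * e (algebraMap K _ ((r : 𝓞 K) : K)) =
      1 + e (algebraMap K (v.adicCompletion K) (((d * r - 1 : 𝓞 K)) : K)) := by
    simp only [RingOfIntegers.coe_eq_algebraMap, map_sub, map_mul, map_one]; ring
  have hnorm1 : ‖(1 : PadicAlgCl ℓ) + e (algebraMap K (v.adicCompletion K) (((d * r - 1 : 𝓞 K)) : K))‖ = 1 := by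
    have hne : ‖(1 : PadicAlgCl ℓ)‖ ≠ ‖e (algebraMap K (v.adicCompletion K) (((d * r - 1 : 𝓞 K)) : K))‖ := by
      rw [norm_one]; exact (ne_of_gt hm)
    rw [IsUltrametricDist.norm_add_eq_max_of_norm_ne_norm hne, norm_one, max_eq_left hm.le]
  have hr1 : ‖e (algebraMap K (v.adicCompletion K) ((r : 𝓞 K) : K))‖ ≤ 1 :=
    norm_embedding_coe_le_one (e.comp (algebraMap K (v.adicCompletion K))) r
  have hprod : ‖e (algebraMap K _ ((d : 𝓞 K) : K))‖ * ‖e (algebraMap K _ ((r : 𝓞 K) : K))‖ = 1 := by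
    rw [← norm_mul, heq, hnorm1]
  have : ‖e (algebraMap K _ ((d : 𝓞 K) : K))‖ * ‖e (algebraMap K _ ((r : 𝓞 K) : K))‖ < 1 :=
    calc _ ≤ ‖e (algebraMap K _ ((d : 𝓞 K) : K))‖ * 1 := mul_le_mul_of_nonneg_left hr1 (norm_nonneg _)
      _ < 1 := by rw [mul_one]; exact h
  exact this.ne hprod

/-- **`v_{e ∘ ι_v} = v`**: the place of the restriction to `K` of a continuous `e : K_v → ℚ̄_ℓ` is `v`.
[folklore] -/
theorem place_comp_algebraMap {v : HeightOneSpectrum (𝓞 K)} (e : v.adicCompletion K →+* PadicAlgCl ℓ)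
    (he : Continuous e) : place (e.comp (algebraMap K (v.adicCompletion K))) = v := by
  refine HeightOneSpectrum.ext (Ideal.ext fun d => ?_)
  change d ∈ ideal _ ↔ _
  rw [mem_ideal_iff, RingHom.comp_apply]
  exact norm_map_algebraMap_lt_one_iff e he d

/-- In particular a place carrying a continuous `K_v → ℚ̄_ℓ` lies above `ℓ`. [folklore] -/
theorem natCast_mem_of_continuous {v : HeightOneSpectrum (𝓞 K)} (e : v.adicCompletion K →+* PadicAlgCl ℓ)
    (he : Continuous e) : ((ℓ : ℕ) : 𝓞 K) ∈ v.asIdeal := by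
  rw [← place_comp_algebraMap e he]; exact natCast_mem_place _

/-- Two continuous `e, e' : K_v → ℚ̄_ℓ` agreeing on `K` are equal. [folklore] -/
theorem eq_of_comp_algebraMap_eq {v : HeightOneSpectrum (𝓞 K)} {e e' : v.adicCompletion K →+* PadicAlgCl ℓ}
    (he : Continuous e) (he' : Continuous e')
    (h : e.comp (algebraMap K (v.adicCompletion K)) = e'.comp (algebraMap K (v.adicCompletion K))) : e = e' :=
  RingHom.ext fun x => congrFun ((denseRange_algebraMap K v).equalizer he he'
    (funext fun a => RingHom.congr_fun h a)) x

variable (K ℓ) in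
/-- **Local embeddings above `ℓ`**: pairs `(v, e)` of a place `v ∣ ℓ` of `K` and a continuous ring
map `e : K_v → ℚ̄_ℓ`. [folklore] -/
def PlaceEmb : Type :=
  Σ v : {v : HeightOneSpectrum (𝓞 K) // ((ℓ : ℕ) : 𝓞 K) ∈ v.asIdeal},
    {e : v.1.adicCompletion K →+* PadicAlgCl ℓ // Continuous e}

/-- The global embedding `e ∘ ι_v : K → ℚ̄_ℓ` of a local one. [folklore] -/
def PlaceEmb.toEmbedding (p : PlaceEmb K ℓ) : K →+* PadicAlgCl ℓ :=
  (p.2.1).comp (algebraMap K (p.1.1.adicCompletion K))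

/-- Unfolding. [folklore] -/
theorem PlaceEmb.toEmbedding_apply (p : PlaceEmb K ℓ) (a : K) :
    p.toEmbedding a = p.2.1 (algebraMap K (p.1.1.adicCompletion K) a) := rfl

/-- The local embedding `(v_τ, τ̂)` of a global one. [folklore] -/
def PlaceEmb.ofEmbedding (τ : K →+* PadicAlgCl ℓ) : PlaceEmb K ℓ :=
  ⟨⟨place τ, natCast_mem_place τ⟩, ⟨lift τ, continuous_lift τ⟩⟩

/-- Unfolding. [folklore] -/
@[simp] theorem PlaceEmb.ofEmbedding_fst (τ : K →+* PadicAlgCl ℓ) : ((PlaceEmb.ofEmbedding τ).1 : HeightOneSpectrum (𝓞 K)) = place τ := rfl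

/-- Unfolding. [folklore] -/
@[simp] theorem PlaceEmb.ofEmbedding_snd (τ : K →+* PadicAlgCl ℓ) : ((PlaceEmb.ofEmbedding τ).2.1 : (place τ).adicCompletion K →+* PadicAlgCl ℓ) = lift τ := rfl

/-- `ofEmbedding` is a right inverse of `toEmbedding`. [folklore] -/
theorem PlaceEmb.toEmbedding_ofEmbedding (τ : K →+* PadicAlgCl ℓ) :
    (PlaceEmb.ofEmbedding τ).toEmbedding = τ :=
  RingHom.ext fun a => lift_algebraMap τ a

/-- **`(v, e) ↦ e ∘ ι_v` is a bijection** from the continuous local embeddings above `ℓ` onto the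
`ℓ`-adic embeddings of `K`. [cite: SerreAbelianLadic1968, Ch. II §3.1] -/
theorem PlaceEmb.toEmbedding_bijective : Function.Bijective (PlaceEmb.toEmbedding (K := K) (ℓ := ℓ)) := by
  refine ⟨fun p q hpq => ?_, fun τ => ⟨PlaceEmb.ofEmbedding τ, PlaceEmb.toEmbedding_ofEmbedding τ⟩⟩
  obtain ⟨⟨v, hv⟩, e, he⟩ := p
  obtain ⟨⟨v', hv'⟩, e', he'⟩ := q
  have hvv : v = v' := by
    have h1 := place_comp_algebraMap e he
    have h2 := place_comp_algebraMap e' he'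
    change place (PlaceEmb.toEmbedding ⟨⟨v, hv⟩, ⟨e, he⟩⟩) = v at h1
    change place (PlaceEmb.toEmbedding ⟨⟨v', hv'⟩, ⟨e', he'⟩⟩) = v' at h2
    rw [← h1, ← h2, hpq]
  subst hvv
  have hee : e = e' := eq_of_comp_algebraMap_eq he he' hpq
  subst hee
  rfl

variable (K ℓ) in
/-- The bijection `(v, e) ↔ τ` as an `Equiv`. [folklore] -/
def placeEmbEquiv : PlaceEmb K ℓ ≃ (K →+* PadicAlgCl ℓ) :=
  Equiv.ofBijective _ PlaceEmb.toEmbedding_bijective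

/-- Unfolding. [folklore] -/
@[simp] theorem placeEmbEquiv_apply (p : PlaceEmb K ℓ) : placeEmbEquiv K ℓ p = p.toEmbedding := rfl

/-- Unfolding of the inverse. [folklore] -/
theorem placeEmbEquiv_symm_apply (τ : K →+* PadicAlgCl ℓ) :
    (placeEmbEquiv K ℓ).symm τ = PlaceEmb.ofEmbedding τ :=
  (placeEmbEquiv K ℓ).injective (by rw [Equiv.apply_symm_apply, placeEmbEquiv_apply, PlaceEmb.toEmbedding_ofEmbedding])

/-- `PlaceEmb K ℓ` is finite (in bijection with the `[K:ℚ]` embeddings `K → ℚ̄_ℓ`). [folklore] -/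
instance : Finite (PlaceEmb K ℓ) := Finite.of_equiv _ (placeEmbEquiv K ℓ).symm

/-- **Reindexing finite products**: `∏_τ f(τ) = ∏_{(v,e)} f(e ∘ ι_v)`. [folklore] -/
theorem finprod_embedding_eq_finprod_placeEmb {M : Type*} [CommMonoid M] (f : (K →+* PadicAlgCl ℓ) → M) :
    ∏ᶠ τ : K →+* PadicAlgCl ℓ, f τ = ∏ᶠ p : PlaceEmb K ℓ, f p.toEmbedding :=
  (finprod_eq_of_bijective _ PlaceEmb.toEmbedding_bijective fun _ => rfl).symm

/-- Every `τ : K → ℚ̄_ℓ` is `e ∘ ι_v` for a unique place `v ∣ ℓ` and continuous `e : K_v → ℚ̄_ℓ`. [folklore] -/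
theorem existsUnique_placeEmb (τ : K →+* PadicAlgCl ℓ) : ∃! p : PlaceEmb K ℓ, p.toEmbedding = τ :=
  (placeEmbEquiv K ℓ).bijective.existsUnique τ

end PadicEmbedding

end Literature.NumberTheory.GaloisRepresentations

end
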